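import Summits.CriticalPhenomena.PercolationContinuityZ3.Theorems.PercNearOneGluingNoHeavyLowerTailThreePartitionCubeCheck

/-!
# Twisted three-partition positivity (★★) = (M⁺-3) on SIX letters: the PAIR-SATURATION CHECKER on the cube, PART 2 —
# lane vectors (batches of pairs), the packed profile / transport / criterion, the enumeration of the 2-coloured antichains, `chunkCheck`

Support file (cell `prim-sahi`, seat `prim-sahi-typer` gen 34; `--supports stmt-CriticalPhenomena-4575`).  COMPUTABLE DEFINITIONS ONLY (no
theorems, no `sorry`); see PART 1 (`…ThreePartitionCubeCheck`) for the encoding and the test; the soundness theorem and the `native_decide`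
evaluations live in companion files.  Reference implementation: `c63b.c` (this seat).

LANES (the packing of typer gen 31's `…SahiPair43CheckPacked`, re-used verbatim: `LW = 96`-bit lanes, guard bit `GB = 90`, offset `BIAS = 4096`,
`ones`, `satsub` = lane-wise truncated subtraction, `lmin` = lane-wise minimum, `laneOf`).  A batch of up to `BATCH = 2048` pairs `(U_i,V_i)` with the
down-set masks `D_i` of their free points is packed into `pu = Σ U_i 2^{96 i}`, `pv`, `pd`; for every twist `t < 2^m` the profiles of all pairs are 2^m
lane vectors (`packedProfile`), the OBLIVIOUS downward transport (every `y`, by decreasing number of coordinates, pulls `min(need, surplus)` from every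
`w ⊋ y`, by increasing number of coordinates) acts on all lanes at once (`packedGreedy`), the relative criterion is evaluated lane-wise (`failLanes`),
and every failing lane is re-examined by the scalar exact test of PART 1.
ENUMERATION.  `walk` visits every antichain of the cube (lowest candidate first), carrying the COORDINATE KEYS
`K_i = 2^40·Σ_{a∋i} 16^{|a|} + Σ_{a≠b, i∈a∩b} 16^{|a∩b|}(3+|a|+|b|)`; a node is expanded iff its keys are non-decreasing (every 2-coloured antichain has
a coordinate permutation sorting the keys of its image — companion soundness file) and its hash is `≡ r (mod M)`; its colourings (first point in the
first class = the swap normal form) are filtered by the chain bound (`#`chains of a symmetric chain decomposition meeting the free points `≥` both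
class sizes), by the minimal-element condition of `PairSat.PairCond`, and by the tie rule (`c¹_i·c²_i` non-decreasing inside ties of `K`, `c^ε_i =
Σ_{a ∈ class ε, a ∋ i} 16^{|a|}`), then batched.  `chunkCheck m M r` = all batches of chunk `r` pass. [this work]
-/

namespace Summit.CriticalPhenomena.PercolationContinuityZ3.Theorems.ThreePartition.Cube

open SahiGridPattern.Pair43 (foldBelow allBelow countBelow LW GB BIAS FMUL ones satsub lmin laneOf)

/-! ### Batches and the packed test -/

/-- Number of pairs per batch. [this work] -/
def BATCH : ℕ := 2048

/-- A batch: number of lanes used and the packed masks `Σ U_i 2^{LW i}`, `Σ V_i 2^{LW i}`, `Σ D_i 2^{LW i}`. [this work] -/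
structure Batch where
  /-- number of pairs in the batch -/
  n : ℕ
  /-- packed first up-sets -/
  pu : ℕ
  /-- packed second up-sets -/
  pv : ℕ
  /-- packed down-sets of the free points -/
  pd : ℕ

/-- The empty batch. [this work] -/
def Batch.empty : Batch := ⟨0, 0, 0, 0⟩

/-- Append a pair to a batch. [this work] -/
def Batch.push (b : Batch) (U V D : ℕ) : Batch :=
  ⟨b.n + 1, b.pu + (U <<< (LW * b.n)), b.pv + (V <<< (LW * b.n)), b.pd + (D <<< (LW * b.n))⟩

/-- Bit `c` of every lane of `p`, as a 0/1 lane vector, for all codes `c`. [this work] -/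
def extractAll (T : Tabs) (one p : ℕ) : Array ℕ := Array.ofFn fun c : Fin T.np => (p >>> c.val) &&& one

/-- The packed profiles at the twist `t`, offset by `BIAS`: entry `y` is the lane vector of `BIAS + c_i(y)`. [this work] -/
def packedProfile (T : Tabs) (one : ℕ) (XU XV XUV : Array ℕ) (t : ℕ) : Array ℕ :=
  Array.ofFn fun y : Fin T.np =>
    let r := (T.np - 1) ^^^ (y.val ^^^ t)
    let L := T.subsL.getD r #[]
    let g := L.foldl (fun acc s => acc + (XU.getD (s ^^^ t) 0 &&& XV.getD ((r ^^^ s) ^^^ t) 0)) 0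
    let fU := L.foldl (fun acc s => acc + XU.getD (s ^^^ t) 0) 0
    let fV := L.foldl (fun acc s => acc + XV.getD (s ^^^ t) 0) 0
    let fUV := L.foldl (fun acc s => acc + XUV.getD (s ^^^ t) 0) 0
    let pos := one * BIAS + (XUV.getD y 0 <<< (T.pcT.getD r 0 + 1)) + g
    let neg := ((XV.getD y 0 * FMUL) &&& fU) + ((XU.getD y 0 * FMUL) &&& fV) + fUV
    pos - neg

/-- One greedy step on lane vectors: `y` pulls `min(need, surplus of w)` from `w`; state = (balances, remaining need). [this work] -/
def pullStep (one g biasV y : ℕ) (st : Array ℕ × ℕ) (w : ℕ) : Array ℕ × ℕ :=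
  if st.2 == 0 then st
  else
    let hav := satsub one g (st.1.getD w 0) biasV
    let tt := lmin one g st.2 hav
    ((st.1.setIfInBounds w (st.1.getD w 0 - tt)).setIfInBounds y (st.1.getD y 0 + tt), st.2 - tt)

/-- All pulls of one point `y` (from every `w ⊋ y`, increasing number of coordinates). [this work] -/
def pullAll (T : Tabs) (one g biasV : ℕ) (u : Array ℕ) (y : ℕ) : Array ℕ :=
  let need0 := satsub one g biasV (u.getD y 0)
  if need0 == 0 then u else ((T.upL.getD y #[]).foldl (pullStep one g biasV y) (u, need0)).1

/-- The oblivious greedy transport on lane vectors. [this work] -/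
def packedGreedy (T : Tabs) (one : ℕ) (u0 : Array ℕ) : Array ℕ :=
  T.descOrd.foldl (pullAll T one (one <<< GB) (one * BIAS)) u0

/-- The relative criterion lane-wise: lanes (as a 0/1 lane vector) where `Σ_{y∉D} u(y) + Σ_{y∈D} min(u(y), BIAS) < 2^m·BIAS`. [this work] -/
def failLanes (T : Tabs) (one : ℕ) (XD : Array ℕ) (u : Array ℕ) : ℕ :=
  let g := one <<< GB
  let biasV := one * BIAS
  let P := foldBelow T.np (fun y acc =>
      let uy := u.getD y 0
      let dy := XD.getD y 0
      acc + ((dy * FMUL) &&& lmin one g uy biasV) + (((one - dy) * FMUL) &&& uy)) 0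
  one ^^^ (((P + g - biasV * T.np) >>> GB) &&& one)

/-- The test of a batch at one twist: packed profile, packed greedy, criterion; every failing lane goes to the scalar test. [this work] -/
def packedTestAt (T : Tabs) (b : Batch) (one : ℕ) (XU XV XUV XD : Array ℕ) (t : ℕ) : Bool :=
  let fl := failLanes T one XD (packedGreedy T one (packedProfile T one XU XV XUV t))
  fl == 0 || allBelow b.n fun i => !(fl.testBit (LW * i)) || scalarTest T (laneOf b.pu i) (laneOf b.pv i) (laneOf b.pd i) t

/-- **The batch test**: all twists. [this work] -/
def packedTest (T : Tabs) (b : Batch) : Bool :=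
  b.n == 0 ||
    (let one := ones b.n
     let XU := extractAll T one b.pu
     let XV := extractAll T one b.pv
     let XUV : Array ℕ := Array.ofFn fun c : Fin T.np => XU.getD c 0 &&& XV.getD c 0
     let XD := extractAll T one b.pd
     allBelow T.np fun t => packedTestAt T b one XU XV XUV XD t)

/-- Append a pair; run the batch test when `BATCH` pairs are collected (`none` = a test failed). [this work] -/
def pushPair (T : Tabs) (b : Batch) (U V D : ℕ) : Option Batch :=
  let b' := b.push U V D
  if b'.n < BATCH then some b' else if packedTest T b' then some Batch.empty else none

/-! ### Colourings of one antichain -/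

/-- Is the `j`-th point of the antichain in the first class under the colouring `mm`? (point `0` always is: swap normal form) [this work] -/
def inFirst (mm j : ℕ) : Bool := decide (j = 0) || mm.testBit (j - 1)

/-- The down-set masks of the two colour classes. [this work] -/
def classDown (T : Tabs) (pts : Array ℕ) (mm : ℕ) : ℕ × ℕ :=
  foldBelow pts.size (fun j acc =>
    let x := pts.getD j 0
    if inFirst mm j then (acc.1 ||| T.subT.getD x 0, acc.2) else (acc.1, acc.2 ||| T.subT.getD x 0)) (0, 0)

/-- `c^ε_i = Σ_{a ∈ class ε, a ∋ i} 16^{|a|}` for the class `ε` selected by `first`. [this work] -/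
def classKey (T : Tabs) (pts : Array ℕ) (mm : ℕ) (first : Bool) (i : ℕ) : ℕ :=
  foldBelow pts.size (fun j acc =>
    let x := pts.getD j 0
    if (inFirst mm j == first) && x.testBit i then acc + w16 (T.pcT.getD x 0) else acc) 0

/-- The tie rule: inside ties of the node keys `K`, `c¹_i·c²_i` is non-decreasing. [this work] -/
def tieOk (T : Tabs) (pts : Array ℕ) (K : Array ℕ) (mm : ℕ) : Bool :=
  allBelow (T.m - 1) fun i => !(K.getD i 0 == K.getD (i + 1) 0) ||
    decide (classKey T pts mm true i * classKey T pts mm false i ≤ classKey T pts mm true (i + 1) * classKey T pts mm false (i + 1))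

/-- Process one colouring: the filters, else append the pair to the batch. [this work] -/
def colourStep (T : Tabs) (pts : Array ℕ) (K : Array ℕ) (cb upN dF : ℕ) (mm : ℕ) (ob : Option Batch) : Option Batch :=
  match ob with
  | none => none
  | some b =>
    let n := pts.size
    let k1 := countBelow n fun j => inFirst mm j
    let k2 := n - k1
    if decide (cb < k1) || decide (cb < k2) then some b
    else
      let dd := classDown T pts mm
      let U := T.full ^^^ dd.1
      let V := T.full ^^^ dd.2
      if !((((minMask T U &&& V) ||| (minMask T V &&& U)) &&& upN) == 0) then some b
      else if !(tieOk T pts K mm) then some b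
      else pushPair T b U V dF

/-- All colourings of the antichain `pts` (`2^(n-1)` of them; one for the empty antichain). [this work] -/
def nodeColourings (T : Tabs) (pts : Array ℕ) (K : Array ℕ) (ob : Option Batch) : Option Batch :=
  let free := T.full ^^^ (T.full &&& orTab T.cmpT pts)
  let cb := chainBound T free
  let upN := orTab T.supT pts
  let dF := orBits T T.subT free
  foldBelow (1 <<< (pts.size - 1)) (colourStep T pts K cb upN dF) ob

/-! ### The enumeration -/

/-- Chunk hash of an array of codes. [this work] -/
def ptsHash (pts : Array ℕ) : ℕ := pts.foldl (fun s x => (s * 89 + x + 1) % 1000003) 7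

/-- The coordinate keys are non-decreasing. [this work] -/
def keySorted (T : Tabs) (K : Array ℕ) : Bool := allBelow (T.m - 1) fun i => decide (K.getD i 0 ≤ K.getD (i + 1) 0)

/-- The first-order keys `S_i = Σ_{a∋i} 16^{|a|}` after adding the point `x`. [this work] -/
def sAdd (T : Tabs) (S : Array ℕ) (x : ℕ) : Array ℕ :=
  Array.ofFn fun i : Fin T.m => S.getD i 0 + (if x.testBit i.val then w16 (T.pcT.getD x 0) else 0)

/-- The full coordinate keys `K_i = 2^40·S_i + Σ_{j<k, i ∈ a_j ∩ a_k} 16^{|a_j ∩ a_k|}(3+|a_j|+|a_k|)` of an antichain. [this work] -/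
def fullKey (T : Tabs) (pts : Array ℕ) : Array ℕ :=
  Array.ofFn fun i : Fin T.m =>
    let s := pts.foldl (fun acc x => if x.testBit i.val then acc + w16 (T.pcT.getD x 0) else acc) 0
    let q := foldBelow pts.size (fun k acc => foldBelow k (fun j acc2 =>
        let p := pts.getD j 0
        let x := pts.getD k 0
        let px := p &&& x
        if px.testBit i.val then acc2 + w16 (T.pcT.getD px 0) * (3 + T.pcT.getD p 0 + T.pcT.getD x 0) else acc2) acc) 0
    s * C40 + q

/-- Node test: sorted first-order keys (cheap necessary condition), sorted full keys, chunk selection; then the colourings. [this work] -/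
def nodeStep (T : Tabs) (M r : ℕ) (pts : Array ℕ) (S : Array ℕ) (ob : Option Batch) : Option Batch :=
  if keySorted T S then
    let K := fullKey T pts
    if keySorted T K && (ptsHash pts % M == r) then nodeColourings T pts K ob else ob
  else ob

/-- Code of the lowest set bit of a nonzero mask. [this work] -/
def lowBit (c : ℕ) : ℕ := (c ^^^ (c &&& (c - 1))).log2

/-- **Enumeration of all antichains** extending `pts` by candidates from `cand` (codes above those of `pts` and incomparable with them), lowest
candidate first, carrying the first-order keys `S` and threading the batch. [this work] -/
def walk (T : Tabs) (M r : ℕ) : ℕ → Array ℕ → Array ℕ → ℕ → Option Batch → Option Batch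
  | 0, _, _, _, ob => ob
  | fuel + 1, pts, S, cand, ob =>
    match ob with
    | none => none
    | some b =>
      if cand = 0 then some b
      else
        let x := lowBit cand
        let above := cand &&& T.nextT.getD x 0
        let pts' := pts.push x
        let S' := sAdd T S x
        let ob1 := nodeStep T M r pts' S' (some b)
        let ob2 := walk T M r fuel pts' S' above ob1
        walk T M r fuel pts S (cand ^^^ (1 <<< x)) ob2

/-- The subtrees of the first points selected by the mask `sel`: for each such `x`, the node `{x}` and all antichains extending it by larger
incomparable codes. [this work] -/
def rootWalk (T : Tabs) (sel M r : ℕ) : ℕ → ℕ → Option Batch → Option Batch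
  | 0, _, ob => ob
  | fuel + 1, x, ob =>
    match ob with
    | none => none
    | some b =>
      if T.np ≤ x then some b
      else
        let ob' :=
          if sel.testBit x then
            let pts : Array ℕ := #[x]
            let S := sAdd T (Array.replicate T.m 0) x
            walk T M r (T.np + 1) pts S (T.nextT.getD x 0) (nodeStep T M r pts S (some b))
          else some b
        rootWalk T sel M r fuel (x + 1) ob'

/-- **The chunk check** for `m` coordinates: the empty antichain (when bit `0` of `sel` is set and `r = 0`), then every antichain whose lowest
code `x` has `sel` bit `x` set and whose hash is `≡ r (mod M)`; colourings batched and tested; the final partial batch tested. [this work] -/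
def chunkCheck (m sel M r : ℕ) : Bool :=
  let T := mkTabs m
  let ob0 : Option Batch :=
    if sel.testBit 0 && (r == 0) then nodeColourings T #[] (Array.replicate m 0) (some Batch.empty) else some Batch.empty
  match rootWalk T sel M r T.np 0 ob0 with
  | none => false
  | some b => packedTest T b

end Summit.CriticalPhenomena.PercolationContinuityZ3.Theorems.ThreePartition.Cube
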